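import Literature.AlgebraicGeometry.Resolution.KangarooAtlasCert
import Mathlib.Algebra.Order.Ring.Rat

/-!
# Kernel-checked rows for the weighted (ATW / AQS) transplant of the kangaroo atlas (`pub-rosobs`, carver-g3)

A computable companion of `Literature.AlgebraicGeometry.Resolution.WeightedBlowupShade`: over the
sparse exponent lists of `KangarooAtlasCert` (`Poly`, coefficients mod `p`) it implements

* the monomial valuation `v_J(u^α) = Σ α_i/c_i` of a COORDINATE centre `J = (x^q, u_i^{c_i})_{i∈S}`
  and the admissibility test `v_J ≥ 1` on every monomial
  [cite: AbramovichTemkinWlodarczyk2024, §5.1 (admissibility via the monomial valuation)],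
  [cite: AbramovichQuekSchober2025, Def. 3.3 / Rem. 3.4];
* the coordinate-restricted lex-max invariant `invCoord q F = (q, c_1 ≤ … ≤ c_k)` (TRANSPLANT
  convention FW2 of the observatory: the maximum, in ATW's order "truncations larger", of the
  invariants of admissible centres that are monomial in the GIVEN coordinates `(x, u)` after cleaning,
  computed by the greedy flag algorithm over all orderings of the variables) — in characteristic `0`
  and with maximisation over all coordinates this maximum is ATW's `inv_p`
  [cite: AbramovichTemkinWlodarczyk2024, Thm. 14 (inv = maximal invariant of an admissible centre)],
  for plane curves in characteristic `p` it is the invariant `(ν, νδ)` of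
  [cite: AbramovichQuekSchober2024, Thm. 4.2 (lex-max characterisation)];
* the reduced-weights test `ℓ·(1/w_0, 1/w_i) = (q, c_i)`, `gcd = 1`
  [cite: AbramovichQuekSchober2025, Def. 4.1 (reduced center, ℓ)];
* the cobordant (degeneration-to-the-weighted-normal-cone) transform `u_i = s^{w_i} u_i'`, division by
  `s^ℓ` — a new variable `s` at index `0` [cite: AbramovichQuekSchober2025, Def. 4.5 (proper
  transform on B)], [cite: Wlodarczyk2022, Def. 2.3.5 (full cobordant blow-up B, B_+)];
* one step at a point `(s = 0, x' = x₀, u' = b)` of the exceptional divisor on `B_+`: translation,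
  the test that the point lies on the proper transform (`F'(0,b) + x₀^q = 0`), removal of the constant,
  cleaning, and the equimultiplicity test `ord ≥ q` (a failing test = the ORDER DROPPED = `none`).

Certified rows (each a `decide`d computation, NOT a theorem about resolution):
(W1) Włodarczyk's Whitney umbrella `x² + y²z` over `𝔽₂` [cite: Temkin2025, §1.2.2
  warning (1): "multiorder (2,3,3) at each closed point of the z-axis"]: `invCoord = (2,3,3)`, weights
  `(3,2,2)`, `ℓ = 6`; at the point `(s,x',y',z') = (0,0,0,1)` of the exceptional divisor (stabiliser
  `μ₂`, no étale slice) the cleaned transform is again `y'² z'` and `invCoord` is again `(2,3,3)`: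
  the transplanted step REPRODUCES ITS INPUT (observatory event `w_inv_stall`; iterating it loops).
(W2) Hauser's kangaroo surface `x² + y⁷ + yz⁴` over `𝔽₂` [cite: Hauser2010, §G]: `invCoord = (2,5,5)`,
  weights `(5,2,2)`, `ℓ = 10`, transform `y'z'⁴ + s⁴y'⁷`; at `(0,0,1,0)` (stabiliser `μ₂`) the point is
  equimultiple, the second entry STALLS (`ord = 5` before and after; in characteristic `0` it is `4`
  there) and `invCoord` becomes `(2,5,5,5)`, smaller than `(2,5,5)` ONLY because truncations are larger.
(W3) AQS's example `x^p − y^{p+1}`, `p = 3` [cite: AbramovichQuekSchober2024, Ex. 5.8]: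
  `invCoord = (3,4)`, weights `(4,3)`, `ℓ = 12`; at both `𝔽₃`-points of the exceptional divisor off the
  vertex the order drops (`none`), as Thm. 1.1(3) of that paper asserts for every plane curve.
(W4) AQS 2025 Ex. 2.2 with `λ = 1` (a square): `y² + x⁴ + x⁵` over `𝔽₂` cleans to `x⁵`, `invCoord = (2,5)`
  (`δ = 5/2`) [cite: AbramovichQuekSchober2025, Ex. 2.2].
(W5) The dimension-4 row of `KangarooAtlasCertDim4` (`x² + y² + z³ + w⁵` over `𝔽₂`, a point-blow-up
  kangaroo at depth 4): cleaned `z³ + w⁵`, `invCoord = (2,3,5)`, weights `(15,10,6)`, `ℓ = 30`; the order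
  drops at all three `𝔽₂`-points of the exceptional divisor off the vertex. (derived here) [folklore]
(W6) ATW's order is not well-founded on sequences of unbounded length:
  `(2,5,5) > (2,5,5,5) > (2,5,5,5,5)` [cite: AbramovichTemkinWlodarczyk2024, §5.1] — on the cobordant
  models the number of variables grows by one per step, so a `TruncLex` decrease of `invCoord` is not by
  itself a termination measure (observatory remark, derived here).
-/

namespace Literature.AlgebraicGeometry.Resolution.KangarooAtlasCertWeighted

open KangarooAtlasCert

/-- `v_J(u^a) = Σ_i a_i · γ_i` for the cocharacter `γ = (1/c_i)` (`γ_i = 0`: variable not in the centre).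
[cite: AbramovichTemkinWlodarczyk2024, §2.4 (monomial valuation of a center)] -/
def val (γ : List ℚ) (a : Mon) : ℚ := ((a.zip γ).map (fun t => (t.1 : ℚ) * t.2)).sum

/-- admissibility of the coordinate centre with cocharacter `γ` for `x^q + F`: `v_J ≥ 1` on every monomial of `F`
(`v_J(x^q) = 1` by the normalisation `γ_x = 1/q`). [cite: AbramovichQuekSchober2025, Def. 3.3] -/
def admissible (γ : List ℚ) (P : Poly) : Bool := P.all (fun t => 1 ≤ val γ t.1)

/-- `A_a = Σ_{j<k} a_{σ j}/c_j`: valuation of `u^a` on the already chosen prefix of the flag. (derived here) [folklore] -/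
def valPrefix (a : Mon) (order : List ℕ) (cs : List ℚ) : ℚ :=
  ((order.zip cs).map (fun t => (a.getD t.1 0 : ℚ) / t.2)).sum

/-- `B_a = Σ_{j ≥ k} a_{σ j}`: total exponent of `u^a` in the not yet weighted variables of the flag. (derived here) [folklore] -/
def tailSum (a : Mon) (order : List ℕ) (k : ℕ) : ℕ := ((order.drop k).map (fun i => a.getD i 0)).sum

/-- minimum of a non-empty list of rationals (head default). [folklore] -/
def minQ : List ℚ → ℚ
  | [] => 0
  | x :: xs => xs.foldl min x

/-- greedy stage of the flag algorithm: `c_k = min_{A_a < 1} B_a/(1 − A_a)`; `none` = no admissible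
coordinate centre on this flag; stops (truncates) when every monomial already has valuation `≥ 1`.
(Transplant convention FW2.) (derived here) [folklore] -/
def greedyAux (mons : List Mon) (order : List ℕ) : ℕ → List ℚ → Option (List ℚ)
  | 0, cs => some cs
  | fuel + 1, cs =>
      let k := cs.length
      let cons := mons.filterMap (fun a => if 1 ≤ valPrefix a order cs then none else some (a, tailSum a order k))
      if cons.any (fun t => t.2 == 0) then none
      else match cons with
        | [] => some cs
        | _ => greedyAux mons order fuel (cs ++ [minQ (cons.map (fun t => (t.2 : ℚ) / (1 - valPrefix t.1 order cs)))])

/-- the greedy (lex-max monotone) exponents `(c_1, …, c_k)` on the flag `order`. (derived here) [folklore] -/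
def greedy (mons : List Mon) (order : List ℕ) : Option (List ℚ) := greedyAux mons order order.length []

/-- ATW's order on invariants as a Boolean: lexicographic, a proper truncation is LARGER.
[cite: AbramovichTemkinWlodarczyk2024, §5.1 (order of invariants)] -/
def truncLexLt : List ℚ → List ℚ → Bool
  | [], _ => false
  | _ :: _, [] => true
  | x :: xs, y :: ys => decide (x < y) || (x == y && truncLexLt xs ys)

/-- all orderings of a list (insertion recursion). [folklore] -/
def perms : List ℕ → List (List ℕ)
  | [] => [[]]
  | x :: xs => (perms xs).flatMap (fun l => (List.range (l.length + 1)).map (fun i => l.take i ++ x :: l.drop i))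

/-- number of variables of a (non-empty) term list. [folklore] -/
def nvars (P : Poly) : ℕ := match P with | [] => 0 | t :: _ => t.1.length

/-- **`invCoord q F`** = `(q, c_1, …, c_k)`: the `truncLex`-maximum over all flags of the greedy centres
(coordinate-restricted lex-max admissible centre; transplant convention FW2). `none` if `F = 0`.
[cite: AbramovichTemkinWlodarczyk2024, Thm. 14 (characteristic 0: inv = max invariant of admissible center)] -/
def invCoord (q : ℕ) (P : Poly) : Option (List ℚ) :=
  ((perms (List.range (nvars P))).filterMap (fun o => (greedy (P.map (·.1)) o).map (fun cs => (q : ℚ) :: cs))).foldl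
    (fun best v => match best with
      | none => some v
      | some b => if truncLexLt b v then some v else some b) none

/-- the flag and exponents realising `invCoord` (first maximiser found): `(S, cs)`. (derived here) [folklore] -/
def centreOf (q : ℕ) (P : Poly) : Option (List ℕ × List ℚ) :=
  ((perms (List.range (nvars P))).filterMap (fun o => (greedy (P.map (·.1)) o).map (fun cs => (o.take cs.length, cs)))).foldl
    (fun best v => match best with
      | none => some v
      | some b => if truncLexLt ((q : ℚ) :: b.2) ((q : ℚ) :: v.2) then some v else some b) none

/-- reduced weights: `c_i · w_i = ℓ = q · w_0` for the centre variables and `gcd(w) = 1`.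
[cite: AbramovichQuekSchober2025, Def. 4.1 (reduced center)] -/
def isReduced (q : ℕ) (cs : List ℚ) (w0 : ℕ) (w : List ℕ) (ℓ : ℕ) : Bool :=
  (ℓ == q * w0) && (cs.length == w.length) && ((cs.zip w).all (fun t => t.1 * (t.2 : ℚ) == (ℓ : ℚ)))
    && ((w.foldl Nat.gcd w0) == 1)

/-- cobordant transform: `u_i = s^{w_i} u_i'` for `i ∈ S`, division by `s^ℓ`; the exceptional variable `s`
is prepended at index `0`. Natural subtraction: meaningful under admissibility (`Σ w_i a_i ≥ ℓ`).
[cite: AbramovichQuekSchober2025, Def. 4.5 (proper transform on B)] -/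
def cobordant (S : List ℕ) (w : List ℕ) (ℓ : ℕ) (P : Poly) : Poly :=
  P.map (fun t => ((((S.zip w).map (fun iw => iw.2 * t.1.getD iw.1 0)).sum - ℓ) :: t.1, t.2))

/-- constant coefficient of a term list. [folklore] -/
def const (P : Poly) : ℕ := match P.find? (fun t => deg t.1 = 0) with | none => 0 | some t => t.2

/-- equality of term lists up to order of terms. [folklore] -/
def sameTerms (A B : Poly) : Bool := (A.length == B.length) && A.all (fun t => B.contains t) && B.all (fun t => A.contains t)

/-- one weighted step seen at the point `(s = 0, x' = x₀, u' = b)` of the exceptional divisor of `B_+`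
(`b` lists the values of ALL old variables; the new variable `s` has value `0`): `none` unless the point
lies on the proper transform (`F'(0,b) + x₀^q ≡ 0`) and is equimultiple (`ord ≥ q` after removing the
constant); otherwise the cleaned new residual polynomial in the variables `(s, u')`.
[cite: AbramovichQuekSchober2025, Def. 4.5 (proper transform on B)] -/
def wstep (p q : ℕ) (S : List ℕ) (w : List ℕ) (ℓ : ℕ) (x0 : ℕ) (b : List ℕ) (P : Poly) : Option Poly :=
  let G := translate p (0 :: b) (cobordant S w ℓ P)
  if (const G + x0 ^ q) % p ≠ 0 then none
  else
    let G' := G.filter (fun t => deg t.1 ≠ 0)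
    if G'.all (fun t => q ≤ deg t.1) then some (clean q G') else none

/-- order of the stabiliser `μ_g` of the point: `g = gcd` of the weights of its non-zero coordinates
(`x₀ ↦ w_0`, `u'_i ↦ w_i`). [cite: AbramovichQuekSchober2025, Lemma 4.4 (3)] -/
def stab (w0 : ℕ) (S : List ℕ) (w : List ℕ) (x0 : ℕ) (b : List ℕ) : ℕ :=
  ((S.zip w).filter (fun iw => b.getD iw.1 0 ≠ 0)).foldl (fun g iw => Nat.gcd g iw.2) (if x0 ≠ 0 then w0 else 0)

/-! ## Certified rows -/

section Rows

/-- (W1) Whitney umbrella `x² + y²z` over `𝔽₂`: `invCoord = (2,3,3)`, centre `(x², y³, z³)`, weights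
`(3,2,2)`, `ℓ = 6`. [cite: Temkin2025, §1.2.2 (multiorder (2,3,3) on the z-axis)] -/
theorem whitney_invCoord :
    invCoord 2 [([2, 1], 1)] = some [2, 3, 3] ∧ centreOf 2 [([2, 1], 1)] = some ([0, 1], [3, 3]) ∧
      isReduced 2 [3, 3] 3 [2, 2] 6 = true := by
  decide +kernel

/-- (W1) the weighted step at `(s,x',y',z') = (0,0,0,1)` returns `y'²z'` again (variables `(s,y',z')`),
with `invCoord` again `(2,3,3)`: a STALL of the transplanted invariant; the stabiliser there is `μ₂`
(`2 ∣ 2`: no étale slice). (derived here) [folklore] -/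
theorem whitney_loop :
    cobordant [0, 1] [2, 2] 6 [([2, 1], 1)] = [([0, 2, 1], 1)] ∧
    wstep 2 2 [0, 1] [2, 2] 6 0 [0, 1] [([2, 1], 1)] = some [([0, 2, 1], 1)] ∧
      invCoord 2 [([0, 2, 1], 1)] = some [2, 3, 3] ∧ stab 3 [0, 1] [2, 2] 0 [0, 1] = 2 := by
  decide +kernel

/-- (W2) Hauser's `x² + y⁷ + yz⁴` over `𝔽₂`: `invCoord = (2,5,5)`, weights `(5,2,2)`, `ℓ = 10`, cobordant
transform `s⁴y'⁷ + y'z'⁴`. [cite: Hauser2010, §G (the polynomial)] -/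
theorem hauser_invCoord :
    invCoord 2 [([7, 0], 1), ([1, 4], 1)] = some [2, 5, 5] ∧ isReduced 2 [5, 5] 5 [2, 2] 10 = true ∧
      cobordant [0, 1] [2, 2] 10 [([7, 0], 1), ([1, 4], 1)] = [([4, 7, 0], 1), ([0, 1, 4], 1)] := by
  decide +kernel

/-- (W2) at `(0,0,1,0)` (stabiliser `μ₂`) the point is equimultiple, the cleaned transform is
`ỹz'⁴ + s⁴ỹ + s⁴ỹ³ + s⁴ỹ⁵ + s⁴ỹ⁷` of order `5` (second entry STALLS at `5`), and `invCoord = (2,5,5,5)`,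
which is `truncLex`-smaller than `(2,5,5)` only by length. (derived here) [folklore] -/
theorem hauser_weighted_step :
    ((wstep 2 2 [0, 1] [2, 2] 10 0 [1, 0] [([7, 0], 1), ([1, 4], 1)]).map fun G =>
        (sameTerms G [([0, 1, 4], 1), ([4, 1, 0], 1), ([4, 3, 0], 1), ([4, 5, 0], 1), ([4, 7, 0], 1)],
          ord G, invCoord 2 G)) = some (true, 5, some [2, 5, 5, 5]) ∧
      truncLexLt [2, 5, 5, 5] [2, 5, 5] = true ∧ stab 5 [0, 1] [2, 2] 0 [1, 0] = 2 := by
  decide +kernel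

/-- (W3) `x³ − y⁴` over `𝔽₃` (AQS Ex. 5.8, `p = 3`): `invCoord = (3,4)`, weights `(4,3)`, `ℓ = 12`; the order
drops at both `𝔽₃`-points `y' = 1, 2` (with `x' = 1`) of the exceptional divisor off the vertex.
[cite: AbramovichQuekSchober2024, Ex. 5.8 and Thm. 1.1 (3)] -/
theorem aqs_example_p3 :
    invCoord 3 [([4], 2)] = some [3, 4] ∧ isReduced 3 [4] 4 [3] 12 = true ∧
      wstep 3 3 [0] [3] 12 1 [1] [([4], 2)] = none ∧ wstep 3 3 [0] [3] 12 1 [2] [([4], 2)] = none ∧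
      stab 4 [0] [3] 1 [1] = 1 := by
  decide +kernel

/-- (W4) AQS 2025 Ex. 2.2 with `λ = 1`: `y² + x⁴ + x⁵` over `𝔽₂` cleans to `x⁵` and `invCoord = (2,5)`
(`δ = 5/2`). [cite: AbramovichQuekSchober2025, Ex. 2.2] -/
theorem aqs25_example_22 :
    clean 2 [([4], 1), ([5], 1)] = [([5], 1)] ∧ invCoord 2 [([5], 1)] = some [2, 5] := by
  decide +kernel

/-- (W5) the dimension-4 kangaroo input `x² + y² + z³ + w⁵` over `𝔽₂` of `KangarooAtlasCertDim4`: cleaned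
residual `z³ + w⁵`, `invCoord = (2,3,5)` (flag `z, w`), weights `(15,10,6)`, `ℓ = 30`, transform
`z'³ + w'⁵`; the order drops at the three `𝔽₂`-points `(z',w') = (1,0),(0,1),(1,1)` (with `x' = 1,1,0`).
(derived here) [folklore] -/
theorem dim4_weighted :
    clean 2 [([2, 0, 0], 1), ([0, 3, 0], 1), ([0, 0, 5], 1)] = [([0, 3, 0], 1), ([0, 0, 5], 1)] ∧
    centreOf 2 [([0, 3, 0], 1), ([0, 0, 5], 1)] = some ([1, 2], [3, 5]) ∧
    isReduced 2 [3, 5] 15 [10, 6] 30 = true ∧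
    cobordant [1, 2] [10, 6] 30 [([0, 3, 0], 1), ([0, 0, 5], 1)] = [([0, 0, 3, 0], 1), ([0, 0, 0, 5], 1)] ∧
    wstep 2 2 [1, 2] [10, 6] 30 1 [0, 1, 0] [([0, 3, 0], 1), ([0, 0, 5], 1)] = none ∧
    wstep 2 2 [1, 2] [10, 6] 30 1 [0, 0, 1] [([0, 3, 0], 1), ([0, 0, 5], 1)] = none ∧
    wstep 2 2 [1, 2] [10, 6] 30 0 [0, 1, 1] [([0, 3, 0], 1), ([0, 0, 5], 1)] = none := by
  decide +kernel

/-- (W6) `(2,5,5) > (2,5,5,5) > (2,5,5,5,5)` in ATW's order: truncations are larger, so lengthening chains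
descend forever. [cite: AbramovichTemkinWlodarczyk2024, §5.1 (order of invariants)] -/
theorem truncLex_length_chain :
    truncLexLt [2, 5, 5, 5] [2, 5, 5] = true ∧ truncLexLt [2, 5, 5, 5, 5] [2, 5, 5, 5] = true := by
  decide +kernel

end Rows

end Literature.AlgebraicGeometry.Resolution.KangarooAtlasCertWeighted
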